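import Mathlib.Combinatorics.SimpleGraph.Clique
import Mathlib.LinearAlgebra.Matrix.PosDef
import Mathlib.Tactic.LinearCombination
import Mathlib.Tactic.Linarith
import Literature.Combinatorics.SimpleGraph.LasserreStableBound
import HarnessLib

/-!
# Feige–Krauthgamer pseudomoments and the reduction to Kunisky–Yu's filled matrix `H`

The first two steps of the proof of Kunisky–Yu 2022, Theorem 3.1 (arXiv:2211.02713, §2.3 steps 1–2,
§3.1), for an ARBITRARY finite graph `G` and arbitrary levels `α : ℕ → ℝ` with `α 0 = 1`:

* `fkMoments G α` — the **Feige–Krauthgamer (FK) pseudomoments** `y_S = α_{|S|}` if `S` is a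
  clique of `G` and `0` otherwise (KY Definition 2.7), as a Laurent moment vector
  `Finset V → ℝ` for the tree's `momentMatrix` / `IsLasserreFeasible` (stable sets of `Ḡ` = cliques
  of `G`, the dictionary of `PaleySos.lean`).
* `bipInd G L R` — the indicator `1_{|L|,|R|}(L, R)` of KY Definition 3.4 (every `v ∈ L ∖ R` is
  adjacent to every `w ∈ R ∖ L`), and `kyFilledMatrix G α` — the matrix `H` of KY (35)–(37) in its
  uniform form `H_{L,R} = α_{|L ∪ R|} 1_{|L|,|R|}(L,R) − α_{|L|} α_{|R|}`, indexed by ALL subsets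
  `L, R` with `1 ≤ |L|, |R| ≤ 2` (singletons and pairs, cliques or not: the "filling").
* `isClique_union_iff_bipInd` — KY Proposition 3.5: for cliques `L, R`, `L ∪ R` is a clique iff
  `1_{|L|,|R|}(L, R) = 1`.
* `posSemidef_momentMatrix_fkMoments` — **`H ⪰ 0 ⟹ M₂(y) ⪰ 0`**: the Schur complement of the
  entry `M_{∅,∅} = 1` is `N = M₊ − m mᵀ` (KY (22)), and `N = D H D` with `D` the diagonal clique
  indicator (KY Proposition 3.5, Remark 2.2), so `xᵀ M x = (x_∅ + mᵀx)² + (Dx)ᵀ H (Dx) ≥ 0`.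
* `isLasserreFeasible_fkMoments`, `sum_fkMoments_singleton`, `card_mul_le_lasserreStableBound_of_kyH`
  — hence `y` is feasible for `las⁽²⁾(Ḡ)` with value `|V|·α₁`, and `|V| α₁ ≤ las⁽²⁾(Ḡ)`.

This is the graph-theoretic (character-sum-free) reduction; the analysis of `H` for the Paley graph
(KY §3.2–§4) is not here.

## References

* [KuniskyYu2022] D. Kunisky, X. Yu, arXiv:2211.02713: Def. 2.7, Remark 2.2, Prop. 2.9, §2.3,
  Def. 3.2, Prop. 3.3, Def. 3.4, (35)–(37), Prop. 3.5.
-/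

noncomputable section

namespace Literature.Combinatorics.SimpleGraph

open Matrix Finset

section NoFintype

variable {V : Type*} [DecidableEq V] (G : _root_.SimpleGraph V) [DecidableRel G.Adj]

/-! ### FK pseudomoments -/

/-- The **Feige–Krauthgamer pseudomoments** with levels `α` (Kunisky–Yu, Definition 2.7:
"`Ẽ[x_S] = α_{|S|}` if `S` is a clique in `G`, `0` otherwise"), as a moment vector on all subsets.
[cite: KuniskyYu2022, Definition 2.7] -/
def fkMoments (α : ℕ → ℝ) : Finset V → ℝ :=
  fun S => if G.IsClique (S : Set V) then α S.card else 0

/-- Unfolding of `fkMoments`. [cite: KuniskyYu2022, Definition 2.7] -/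
theorem fkMoments_apply (α : ℕ → ℝ) (S : Finset V) :
    fkMoments G α S = if G.IsClique (S : Set V) then α S.card else 0 := rfl

/-- On a clique, `y_S = α_{|S|}`. [cite: KuniskyYu2022, Definition 2.7] -/
theorem fkMoments_of_isClique (α : ℕ → ℝ) {S : Finset V} (h : G.IsClique (S : Set V)) :
    fkMoments G α S = α S.card := if_pos h

/-- Off cliques, `y_S = 0`. [cite: KuniskyYu2022, Definition 2.7] -/
theorem fkMoments_of_not_isClique (α : ℕ → ℝ) {S : Finset V} (h : ¬ G.IsClique (S : Set V)) :
    fkMoments G α S = 0 := if_neg h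

/-- `y_∅ = α₀`. [cite: KuniskyYu2022, Definition 2.7] -/
theorem fkMoments_empty (α : ℕ → ℝ) : fkMoments G α ∅ = α 0 := by
  rw [fkMoments_of_isClique G α (by simp)]; rfl

/-- `y_{v} = α₁`. [cite: KuniskyYu2022, Definition 2.7] -/
theorem fkMoments_singleton (α : ℕ → ℝ) (v : V) : fkMoments G α {v} = α 1 := by
  rw [fkMoments_of_isClique G α (by simp), card_singleton]

/-- `y_{uv} = 0` on non-edges (`u ≠ v`, `u ≁ v`): the FK vector satisfies the pair (edge) constraints
of the stable-set program of `Ḡ` ("FK pseudomoments automatically satisfy all conditions on a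
pseudoexpectation other than positivity"). [cite: KuniskyYu2022, Definition 2.7] -/
theorem fkMoments_pair_of_not_adj (α : ℕ → ℝ) {u v : V} (huv : u ≠ v) (h : ¬ G.Adj u v) :
    fkMoments G α {u, v} = 0 := by
  refine fkMoments_of_not_isClique G α fun hc => h ?_
  rw [coe_pair, SimpleGraph.isClique_pair] at hc
  exact hc huv

/-! ### The bipartite indicator and the filled matrix `H` -/

/-- **Kunisky–Yu, Definition 3.4**: `1_{ℓ,r}(L, R) = 1` iff `v ∼ w` for all `v ∈ L ∖ R`,
`w ∈ R ∖ L`, as a real number. [cite: KuniskyYu2022, Definition 3.4] -/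
def bipInd (L R : Finset V) : ℝ :=
  if ∀ v ∈ L \ R, ∀ w ∈ R \ L, G.Adj v w then 1 else 0

/-- Unfolding of `bipInd`. [cite: KuniskyYu2022, Definition 3.4] -/
theorem bipInd_apply (L R : Finset V) :
    bipInd G L R = if ∀ v ∈ L \ R, ∀ w ∈ R \ L, G.Adj v w then 1 else 0 := rfl

omit [DecidableRel G.Adj] in
/-- **Kunisky–Yu, Proposition 3.5** (its proof: "for `|L|, |R| ≤ 2` we have
`1_{|L∪R|}(L ∪ R) = 1_{|L|,|R|}(L, R)` so long as `L` is an edge if `|L| = 2` and `R` is an edge if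
`|R| = 2`"), for cliques `L, R` of any size: `L ∪ R` is a clique iff every vertex of `L ∖ R` is
adjacent to every vertex of `R ∖ L`. [cite: KuniskyYu2022, Proposition 3.5] -/
theorem isClique_union_iff_bipInd {L R : Finset V} (hL : G.IsClique (L : Set V))
    (hR : G.IsClique (R : Set V)) :
    G.IsClique ((L ∪ R : Finset V) : Set V) ↔ ∀ v ∈ L \ R, ∀ w ∈ R \ L, G.Adj v w := by
  constructor
  · intro h v hv w hw
    rw [mem_sdiff] at hv hw
    have hne : v ≠ w := fun hvw => hv.2 (hvw ▸ hw.1)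
    exact h (by simp [hv.1]) (by simp [hw.1]) hne
  · intro h v hv w hw hne
    rw [coe_union, Set.mem_union, mem_coe, mem_coe] at hv hw
    by_cases hvL : v ∈ L <;> by_cases hwL : w ∈ L
    · exact hL hvL hwL hne
    · have hwR : w ∈ R := hw.resolve_left hwL
      by_cases hvR : v ∈ R
      · exact hR hvR hwR hne
      · exact h v (mem_sdiff.2 ⟨hvL, hvR⟩) w (mem_sdiff.2 ⟨hwR, hwL⟩)
    · have hvR : v ∈ R := hv.resolve_left hvL
      by_cases hwR : w ∈ R
      · exact hR hvR hwR hne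
      · exact (h w (mem_sdiff.2 ⟨hwL, hwR⟩) v (mem_sdiff.2 ⟨hvR, hvL⟩)).symm
    · exact hR (hv.resolve_left hvL) (hw.resolve_left hwL) hne

/-- The index type of Kunisky–Yu's `H`: subsets of size `1` or `2` (singletons and pairs).
[cite: KuniskyYu2022, (29)] -/
abbrev PairIdx (V : Type*) := {S : Finset V // 1 ≤ S.card ∧ S.card ≤ 2}

/-- The nonempty part of the level-`2` index embeds into `{S // S.card ≤ 2}`. [folklore] -/
def PairIdx.toLevelTwo {V : Type*} (L : PairIdx V) : {S : Finset V // S.card ≤ 2} := ⟨L.1, L.2.2⟩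

/-- **Kunisky–Yu's filled matrix `H`** ((29), (35)–(37)) with general levels `α`:
`H_{L,R} = α_{|L∪R|} · 1_{|L|,|R|}(L, R) − α_{|L|} α_{|R|}` for `1 ≤ |L|, |R| ≤ 2` — for singletons and
pairs this is exactly (35)–(37) (`H^{1,1}_{a,b} = α₂1_{1,1} − α₁²`, `H^{1,2}_{a,bc} = α₂ − α₁α₂` if
`a ∈ {b,c}` else `α₃1_{1,2} − α₁α₂`, `H^{2,2}` likewise with `α₂ − α₂²`, `α₃1_{2,2} − α₂²`,
`α₄1_{2,2} − α₂²`). [cite: KuniskyYu2022, (35)–(37)] -/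
def kyFilledMatrix (α : ℕ → ℝ) : Matrix (PairIdx V) (PairIdx V) ℝ :=
  of fun L R => α (L.1 ∪ R.1).card * bipInd G L.1 R.1 - α L.1.card * α R.1.card

/-- Entries of `kyFilledMatrix`. [cite: KuniskyYu2022, (35)–(37)] -/
theorem kyFilledMatrix_apply (α : ℕ → ℝ) (L R : PairIdx V) :
    kyFilledMatrix G α L R = α (L.1 ∪ R.1).card * bipInd G L.1 R.1 - α L.1.card * α R.1.card :=
  rfl

/-- The Schur-complement entries `y_{L∪R} − y_L y_R` of the FK moment matrix are `d_L d_R H_{L,R}`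
with `d` the clique indicator (KY Proposition 3.3 with Remark 2.2 and Proposition 3.5: `N` is the
principal submatrix of `H` on cliques, bordered by zero rows). [cite: KuniskyYu2022, Proposition 3.5] -/
theorem fkMoments_union_sub_mul (α : ℕ → ℝ) (L R : Finset V) :
    fkMoments G α (L ∪ R) - fkMoments G α L * fkMoments G α R =
      (if G.IsClique (L : Set V) then 1 else 0) * (if G.IsClique (R : Set V) then 1 else 0) *
        (α (L ∪ R).card * bipInd G L R - α L.card * α R.card) := by
  by_cases hL : G.IsClique (L : Set V)
  · by_cases hR : G.IsClique (R : Set V)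
    · rw [if_pos hL, if_pos hR, fkMoments_of_isClique G α hL, fkMoments_of_isClique G α hR,
        one_mul, one_mul, bipInd_apply]
      by_cases hLR : G.IsClique ((L ∪ R : Finset V) : Set V)
      · rw [fkMoments_of_isClique G α hLR, if_pos ((isClique_union_iff_bipInd G hL hR).1 hLR),
          mul_one]
      · rw [fkMoments_of_not_isClique G α hLR,
          if_neg (fun h => hLR ((isClique_union_iff_bipInd G hL hR).2 h)), mul_zero]
    · have hLR : ¬ G.IsClique ((L ∪ R : Finset V) : Set V) := fun h =>
        hR (h.subset (by rw [coe_union]; exact Set.subset_union_right))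
      rw [if_neg hR, fkMoments_of_not_isClique G α hR, fkMoments_of_not_isClique G α hLR]
      ring
  · have hLR : ¬ G.IsClique ((L ∪ R : Finset V) : Set V) := fun h =>
      hL (h.subset (by rw [coe_union]; exact Set.subset_union_left))
    rw [if_neg hL, fkMoments_of_not_isClique G α hL, fkMoments_of_not_isClique G α hLR]
    ring

end NoFintype

section WithFintype

variable {V : Type*} [Fintype V] [DecidableEq V] (G : _root_.SimpleGraph V) [DecidableRel G.Adj]

/-- The FK objective value `Σ_v y_v = |V| α₁`. [cite: KuniskyYu2022, (26)] -/
theorem sum_fkMoments_singleton (α : ℕ → ℝ) :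
    ∑ v, fkMoments G α {v} = Fintype.card V * α 1 := by
  simp only [fkMoments_singleton, sum_const, card_univ, nsmul_eq_mul]

omit [DecidableEq V] in
/-- Splitting a sum over `{S // |S| ≤ 2}` into the empty set and the sets of size `1, 2`.
[folklore] -/
theorem sum_levelTwo_eq_add_sum_pairIdx (f : {S : Finset V // S.card ≤ 2} → ℝ) :
    ∑ I, f I = f ⟨∅, by simp⟩ + ∑ L : PairIdx V, f L.toLevelTwo := by
  classical
  let e : Option (PairIdx V) ≃ {S : Finset V // S.card ≤ 2} :=
    { toFun := fun o => o.elim ⟨∅, by simp⟩ PairIdx.toLevelTwo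
      invFun := fun I => if h : I.1.card = 0 then none else some ⟨I.1, ⟨by omega, I.2⟩⟩
      left_inv := by
        rintro (_ | ⟨L, hL⟩)
        · simp
        · have h : ¬ L.card = 0 := by omega
          simp [PairIdx.toLevelTwo, h]
      right_inv := by
        rintro ⟨I, hI⟩
        by_cases h : I.card = 0
        · have hI0 : I = ∅ := card_eq_zero.1 h
          subst hI0
          simp
        · simp [h, PairIdx.toLevelTwo] }
  rw [← Fintype.sum_equiv e (fun o => f (e o)) f (fun _ => rfl), Fintype.sum_option]
  rfl

omit [DecidableEq V] in
/-- Splitting a double sum over `{S // |S| ≤ 2}` into its `∅/∅`, `∅/±`, `±/∅`, `±/±` parts.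
[folklore] -/
theorem sum_sum_levelTwo_eq (F : {S : Finset V // S.card ≤ 2} → {S : Finset V // S.card ≤ 2} → ℝ) :
    ∑ I, ∑ J, F I J = F ⟨∅, by simp⟩ ⟨∅, by simp⟩ + ∑ R : PairIdx V, F ⟨∅, by simp⟩ R.toLevelTwo +
      ∑ L : PairIdx V, F L.toLevelTwo ⟨∅, by simp⟩ +
      ∑ L : PairIdx V, ∑ R : PairIdx V, F L.toLevelTwo R.toLevelTwo := by
  rw [sum_levelTwo_eq_add_sum_pairIdx, sum_levelTwo_eq_add_sum_pairIdx (F _)]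
  simp only [sum_levelTwo_eq_add_sum_pairIdx (F (PairIdx.toLevelTwo _)), Finset.sum_add_distrib]
  ring

/-- **`H ⪰ 0 ⟹ M₂(y) ⪰ 0` for FK pseudomoments** (Kunisky–Yu §2.3, steps 1–2: "it suffices to
show that the Schur complement `N` … is positive semidefinite" and "if `H ⪰ 0`, then `N ⪰ 0` as
well"; here as the identity `xᵀ M₂(y) x = (x_∅ + Σ_L y_L x_L)² + (Dx)ᵀ H (Dx)` with `D` the clique
indicator, valid for any graph and any levels with `α₀ = 1`).
[cite: KuniskyYu2022, §2.3 and Proposition 3.5] -/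
theorem posSemidef_momentMatrix_fkMoments (α : ℕ → ℝ) (hα : α 0 = 1)
    (hH : (kyFilledMatrix G α).PosSemidef) : (momentMatrix 2 (fkMoments G α)).PosSemidef := by
  classical
  set y := fkMoments G α with hy
  have hy0 : y ∅ = 1 := by rw [hy, fkMoments_empty, hα]
  refine PosSemidef.of_dotProduct_mulVec_nonneg ?_ fun x => ?_
  · ext I J
    simp only [conjTranspose_apply, star_trivial, momentMatrix_apply, union_comm]
  -- notation
  let x0 : ℝ := x ⟨∅, by simp⟩
  let xx : PairIdx V → ℝ := fun L => x L.toLevelTwo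
  let d : PairIdx V → ℝ := fun L => if G.IsClique (L.1 : Set V) then 1 else 0
  let z : PairIdx V → ℝ := fun L => d L * xx L
  let s : ℝ := ∑ L : PairIdx V, y L.1 * xx L
  let W : ℝ := ∑ L : PairIdx V, ∑ R : PairIdx V, xx L * xx R * y (L.1 ∪ R.1)
  -- the moment quadratic form
  have hQ : star x ⬝ᵥ (momentMatrix 2 y *ᵥ x) = x0 ^ 2 + 2 * x0 * s + W := by
    have h1 : star x ⬝ᵥ (momentMatrix 2 y *ᵥ x) = ∑ I, ∑ J, x I * (y (I.1 ∪ J.1) * x J) := by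
      simp only [star_trivial, dotProduct, mulVec, momentMatrix_apply, Finset.mul_sum]
    rw [h1, sum_sum_levelTwo_eq (fun I J => x I * (y (I.1 ∪ J.1) * x J))]
    have e00 : x ⟨∅, by simp⟩ * (y (∅ ∪ ∅) * x ⟨∅, by simp⟩) = x0 ^ 2 := by
      rw [union_empty, hy0]; simp only [x0]; ring
    have e0R : ∑ R : PairIdx V, x ⟨∅, by simp⟩ * (y (∅ ∪ R.toLevelTwo.1) * x R.toLevelTwo) =
        x0 * s := by
      simp only [s, Finset.mul_sum, PairIdx.toLevelTwo, empty_union, xx, x0]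
    have eL0 : ∑ L : PairIdx V, x L.toLevelTwo * (y (L.toLevelTwo.1 ∪ ∅) * x ⟨∅, by simp⟩) =
        x0 * s := by
      simp only [s, Finset.mul_sum, PairIdx.toLevelTwo, union_empty, xx, x0]
      exact Finset.sum_congr rfl fun L _ => by ring
    have eLR : ∑ L : PairIdx V, ∑ R : PairIdx V,
        x L.toLevelTwo * (y (L.toLevelTwo.1 ∪ R.toLevelTwo.1) * x R.toLevelTwo) = W := by
      simp only [W, PairIdx.toLevelTwo, xx]
      exact Finset.sum_congr rfl fun L _ => Finset.sum_congr rfl fun R _ => by ring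
    rw [e00, e0R, eL0, eLR]
    ring
  -- the `H` quadratic form
  have hR : star z ⬝ᵥ (kyFilledMatrix G α *ᵥ z) = W - s ^ 2 := by
    simp only [star_trivial, dotProduct, mulVec, kyFilledMatrix_apply, Finset.mul_sum]
    have hz : ∀ L R : PairIdx V, z L * ((α (L.1 ∪ R.1).card * bipInd G L.1 R.1 -
        α L.1.card * α R.1.card) * z R) =
          xx L * xx R * y (L.1 ∪ R.1) - y L.1 * xx L * (y R.1 * xx R) := by
      intro L R
      have h := fkMoments_union_sub_mul G α L.1 R.1
      rw [← hy] at h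
      simp only [z, d]
      linear_combination (-(xx L * xx R)) * h
    simp only [hz, Finset.sum_sub_distrib]
    congr 1
    rw [sq, Finset.sum_mul_sum]
  have h0 : 0 ≤ star z ⬝ᵥ (kyFilledMatrix G α *ᵥ z) := hH.dotProduct_mulVec_nonneg z
  rw [hQ]
  rw [hR] at h0
  nlinarith [sq_nonneg (x0 + s)]

/-- **FK pseudomoments are Lasserre-feasible once `H ⪰ 0`** (Kunisky–Yu §2.3: "FK pseudomoments
automatically satisfy all conditions on a pseudoexpectation other than positivity"): with `α₀ = 1`
and `H ⪰ 0`, `y` is feasible for the level-`2` stable-set program of `Ḡ` (cliques of `G`).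
[cite: KuniskyYu2022, §2.3] -/
theorem isLasserreFeasible_fkMoments (α : ℕ → ℝ) (hα : α 0 = 1)
    (hH : (kyFilledMatrix G α).PosSemidef) : IsLasserreFeasible Gᶜ 2 (fkMoments G α) := by
  refine ⟨by rw [fkMoments_empty, hα], fun u v huv => ?_, posSemidef_momentMatrix_fkMoments G α hα hH⟩
  rw [SimpleGraph.compl_adj] at huv
  exact fkMoments_pair_of_not_adj G α huv.1 huv.2

/-- **The FK lower bound**: if `H ⪰ 0` for levels `α` with `α₀ = 1`, then `|V|·α₁ ≤ las⁽²⁾(Ḡ)`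
(Kunisky–Yu (26): "`SOS₄(G_p) ≥ p · cp^{-2/3} = cp^{1/3}`" once Theorem 3.1 gives feasibility).
[cite: KuniskyYu2022, (26)] -/
theorem card_mul_le_lasserreStableBound_of_kyFilledMatrix (α : ℕ → ℝ) (hα : α 0 = 1)
    (hH : (kyFilledMatrix G α).PosSemidef) :
    Fintype.card V * α 1 ≤ lasserreStableBound Gᶜ 2 := by
  rw [← sum_fkMoments_singleton G α]
  exact (isLasserreFeasible_fkMoments G α hα hH).sum_singleton_le_lasserreStableBound (by norm_num)

end WithFintype

end Literature.Combinatorics.SimpleGraph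

end
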